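import Summits.CriticalPhenomena.Ising3D.TaylorTableOddCoeffTM2Div
import HarnessLib

/-!
# The TABLE layer XXIVc: the τ-triple rows are sound (`tmem_rows2`), `tpmem_split`, `pmem_t3bound`
(cell `pub-ising3x`, seat boot-1 gen 15/16; the MERGED-2 (first-order) odd-head test chain, landed per LEAN-PLAN-MERGED2 in ten modules)

HONEST FRAMING: lottery ticket; floor = tightest certified 3D Ising CFT bounds; no exact-solution
claim without a proof. Island framing: certified exclusion region at stated derivative order and
assumptions; not a determination of the 3D Ising critical exponents beyond that.

Drafted and kernel-checked as one combined file (oddtest2/lean-draft/Merged2CellCombined.lean, 83 theorems, standard axioms); landed in slices of ≤ 400 lines. [folklore]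
-/

namespace Summit.CriticalPhenomena.Ising3D

open Finset Set
open Literature.Analysis.ValidatedNumerics Literature.Analysis.ValidatedNumerics.PolyMP
open Literature.Analysis.ValidatedNumerics.NumericsMP
open Literature.MathematicalPhysics.QuantumFieldTheory.ConformalBootstrap3D
open Literature.MathematicalPhysics.QuantumFieldTheory.ConformalBootstrap3D.HRTM
open Literature.MathematicalPhysics.QuantumFieldTheory.ConformalBootstrap3D.PointKernel (mulQ mem_mulQ legendreLamQ)

namespace HRTMAB2

/-! ### The rows: level 0, the pole entry, the generic step, and the induction (mirror of `HRTMAB.rows_ok`) -/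

/-- Entry `(n, j)` of a triple table (levels newest first). [folklore] -/
def rowEntry2 (rs : List (List TPoly)) (nF n j : ℕ) : TPoly := (rs.getD (nF - n) []).getD j []

/-- A function vanishing identically is enclosed by the empty triple model. [folklore] -/
theorem tmem2_nil_of_eq_zero {S : ℕ} {h : ℚ} {W : ℝ} {F : ℝ → ℝ → ℝ} (hF : ∀ ρ τ, F ρ τ = 0) : TMem2 S h W F [] :=
  fun ρ _ => ⟨[], List.Forall₂.nil, fun τ _ => by simp [evalF, hF ρ τ]⟩

/-- [folklore] -/
theorem length_entryTMI2 (S e D : ℕ) (Wn : ℤ) (Wd : ℕ) (Gp Gm : T3 × T3 × T3) (p0 p1 : ℚ) (Pp Pm : TPoly) :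
    (entryTMI2 S e D Wn Wd Gp Gm p0 p1 Pp Pm).length = D + 1 := by
  simp [entryTMI2, zip3]

/-- The pole entry's triple model is exact: `R_{1,ℓ−1}(a(τ), b(τ); A+ρ) = c·(α + 2a(τ) + ρ)(α + 2b(τ) + ρ)`. [cite: DolanOsborn2004, §3 eq. (3.12)] -/
theorem tmem_poleTM2 {S : ℕ} (h : ℚ) (W : ℝ) (A : ℚ) {ℓ : ℕ} (hℓ : 1 ≤ ℓ) (a0 a1 b0 b1 : ℚ) :
    TMem2 S h W (fun ρ τ => regAB ((a0 : ℝ) + (a1 : ℝ) * τ) ((b0 : ℝ) + (b1 : ℝ) * τ) ((A : ℝ) + ρ) ℓ 1 (ℓ - 1))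
      (poleTM2 S A ℓ a0 a1 b0 b1) := by
  intro ρ _
  obtain ⟨m0, m1, m2⟩ := T3.mem_quadI2 S W ((ℓ : ℚ) / (2 * (2 * ℓ + 1))) (A - ℓ - 1) a0 a1 b0 b1
  refine ⟨[_, _, _], List.Forall₂.cons m0 (List.Forall₂.cons m1 (List.Forall₂.cons m2 List.Forall₂.nil)), ?_⟩
  intro τ _
  have hR : InDescendantRange ℓ (0 + 1) (ℓ - 1) := ⟨by omega, by omega, by omega⟩
  show regAB _ _ ((A : ℝ) + ρ) ℓ (0 + 1) (ℓ - 1) = _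
  rw [regAB, if_pos hR, if_pos ⟨rfl, by omega⟩, hrGammaMinusAB]
  simp only [evalF, mul_zero, add_zero]
  have h2 : (2 : ℝ) * (ℓ : ℝ) + 1 ≠ 0 := by positivity
  push_cast
  field_simp
  ring

set_option maxRecDepth 16384 in
set_option maxHeartbeats 800000 in
/-- **Soundness of one recursion step** (non-exceptional in-range pair), τ-triple version (mirror of `HRTMAB.tmem_stepEntry_rec`).
[cite: DolanOsborn2004, §3 eq. (3.12)] -/
theorem tmem_stepEntry2 {S : ℕ} (hS : 0 < S) {Wn : ℤ} {Wd : ℕ} (hWd : 0 < Wd) {A : ℚ} {ℓ e D n j : ℕ} {a0 a1 b0 b1 : ℚ}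
    {row : List TPoly}
    (hrow : ∀ j', TMem2 S ((1 : ℚ) / 2 ^ e) ((Wn : ℝ) / Wd)
      (fun ρ τ => regAB ((a0 : ℝ) + (a1 : ℝ) * τ) ((b0 : ℝ) + (b1 : ℝ) * τ) ((A : ℝ) + ρ) ℓ n j') (row.getD j' []))
    (hlen : ∀ j', (row.getD j' []).length ≤ D + 1) (hR : InDescendantRange ℓ (n + 1) j)
    (hx : ¬ (n = 0 ∧ j + 1 = ℓ)) (hm : 0 < pivMargin e (p0Q A ℓ n j) (p1Q n)) :
    TMem2 S ((1 : ℚ) / 2 ^ e) ((Wn : ℝ) / Wd)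
      (fun ρ τ => regAB ((a0 : ℝ) + (a1 : ℝ) * τ) ((b0 : ℝ) + (b1 : ℝ) * τ) ((A : ℝ) + ρ) ℓ (n + 1) j)
      (stepEntry2 S A ℓ e D Wn Wd a0 a1 b0 b1 n j row) := by
  rw [stepEntry2, if_pos hR, if_neg hx]
  have hh : ((((1 : ℚ) / 2 ^ e : ℚ)) : ℝ) = 1 / 2 ^ e := by push_cast; ring
  obtain ⟨p0m, p1m, p2m⟩ := T3.mem_quadI2 S ((Wn : ℝ) / Wd) (if j = 0 then 0 else (j : ℚ) / (2 * j - 1)) (A + n + j - 1) a0 a1 b0 b1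
  obtain ⟨q0m, q1m, q2m⟩ := T3.mem_quadI2 S ((Wn : ℝ) / Wd) (((j : ℚ) + 1) / (2 * j + 3)) (A + n - j - 2) a0 a1 b0 b1
  have hp : ∀ ρ : ℝ, |ρ| ≤ 1 / 2 ^ e → casimirPivot3D ((A : ℝ) + ρ) ℓ (n + 1) j ≠ 0 := by
    intro ρ hρ
    rw [HRTM.casimirPivot3D_eq]
    have h1 := pivMargin_le_abs (p0Q A ℓ n j) (p1Q n) hρ
    have h2 : ((pivMargin e (p0Q A ℓ n j) (p1Q n) : ℚ) : ℝ) = |(p0Q A ℓ n j : ℝ)| - |(p1Q n : ℝ)| / 2 ^ e := by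
      simp only [pivMargin]; push_cast; ring
    have h3 : (0 : ℝ) < |(p0Q A ℓ n j : ℝ)| - |(p1Q n : ℝ)| / 2 ^ e := by rw [← h2]; exact_mod_cast hm
    intro h0; rw [h0, abs_zero] at h1; linarith
  by_cases hj : j = 0
  · subst hj
    simp only [if_true] at p0m p1m p2m ⊢
    refine tmem_entryTMI2 hS hWd p0m p1m p2m q0m q1m q2m (fp := fun _ _ => 0) (tmem2_nil_of_eq_zero fun _ _ => rfl)
      (hrow 1) (by simp) (hlen 1) hm ?_
    intro ρ τ hρ _
    rw [hh] at hρ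
    have hrec := regAB_succ_rec (a := (a0 : ℝ) + (a1 : ℝ) * τ) (b := (b0 : ℝ) + (b1 : ℝ) * τ) hR hx (hp ρ hρ)
    rw [HRTM.casimirPivot3D_eq] at hrec
    rw [hrec, if_pos rfl, hrGammaMinusAB]
    push_cast; ring
  · obtain ⟨j', rfl⟩ : ∃ j', j = j' + 1 := ⟨j - 1, by omega⟩
    simp only [Nat.add_sub_cancel, if_neg (Nat.succ_ne_zero j')] at p0m p1m p2m ⊢
    refine tmem_entryTMI2 hS hWd p0m p1m p2m q0m q1m q2m (hrow j') (hrow (j' + 1 + 1)) (hlen j')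
      (hlen (j' + 1 + 1)) hm ?_
    intro ρ τ hρ _
    rw [hh] at hρ
    have hrec := regAB_succ_rec (a := (a0 : ℝ) + (a1 : ℝ) * τ) (b := (b0 : ℝ) + (b1 : ℝ) * τ) hR hx (hp ρ hρ)
    rw [HRTM.casimirPivot3D_eq] at hrec
    rw [hrec, if_neg (Nat.succ_ne_zero j'), Nat.add_sub_cancel, hrGammaPlusAB, hrGammaMinusAB]
    have h1 : (2 : ℝ) * (j' : ℝ) + 1 ≠ 0 := by positivity
    have h3 : (2 : ℝ) * ((j' : ℝ) + 1 + 1) + 1 ≠ 0 := by positivity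
    have h1' : (2 : ℝ) * ((j' : ℝ) + 1) - 1 ≠ 0 := by
      rw [show (2 : ℝ) * ((j' : ℝ) + 1) - 1 = 2 * (j' : ℝ) + 1 by ring]; exact h1
    have h3' : (2 : ℝ) * ((j' : ℝ) + 1) + 3 ≠ 0 := by positivity
    push_cast
    field_simp
    ring

/-- What the induction maintains (τ-triple version of `RowsOK`). [folklore] -/
def RowsOK2 (S : ℕ) (A : ℚ) (ℓ e D : ℕ) (Wn : ℤ) (Wd : ℕ) (a0 a1 b0 b1 : ℚ) (nF : ℕ) (rs : List (List TPoly)) : Prop :=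
  ∀ n ≤ nF, ∀ j, TMem2 S ((1 : ℚ) / 2 ^ e) ((Wn : ℝ) / Wd)
      (fun ρ τ => regAB ((a0 : ℝ) + (a1 : ℝ) * τ) ((b0 : ℝ) + (b1 : ℝ) * τ) ((A : ℝ) + ρ) ℓ n j) (rowEntry2 rs nF n j) ∧
    (rowEntry2 rs nF n j).length ≤ D + 1

set_option maxHeartbeats 800000 in
/-- **Soundness of the τ-triple Taylor-model recursion for the regularised array** (mirror of `HRTMAB.rows_ok`). [cite: DolanOsborn2004, §3 eq. (3.12)] -/
theorem rows2_ok {S : ℕ} (hS : 0 < S) {Wn : ℤ} {Wd : ℕ} (hWd : 0 < Wd) (A : ℚ) (ℓ e D : ℕ) (hD : 2 ≤ D) (a0 a1 b0 b1 : ℚ) :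
    ∀ nF, PivCond A ℓ e nF → RowsOK2 S A ℓ e D Wn Wd a0 a1 b0 b1 nF (rows2 S A ℓ e D Wn Wd a0 a1 b0 b1 nF) := by
  intro nF
  induction nF with
  | zero =>
    intro _ n hn j
    obtain rfl : n = 0 := Nat.le_zero.mp hn
    simp only [rowEntry2, rows2, Nat.sub_zero, List.getD_cons_zero, getD_vtab]
    by_cases hj : j < ℓ + 1
    · rw [if_pos hj]
      by_cases hjl : j = ℓ
      · subst hjl
        rw [if_pos rfl]
        refine ⟨fun ρ _ => ⟨[fun _ => ((A - bQ j : ℚ) : ℝ), fun _ => ((1 : ℚ) : ℝ)],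
          List.Forall₂.cons ((T3.Mem_congr fun τ => by push_cast; ring).mp (T3.mem_ofRat3 S _ (A - bQ j) 0 0))
            (List.Forall₂.cons ((T3.Mem_congr fun τ => by push_cast; ring).mp (T3.mem_ofRat3 S _ 1 0 0)) List.Forall₂.nil),
          fun τ _ => ?_⟩, by simp; omega⟩
        simp only [regAB, if_true, evalF, mul_zero, add_zero]
        rw [← cast_bQ]; push_cast; ring
      · rw [if_neg hjl]
        exact ⟨tmem2_nil_of_eq_zero fun ρ τ => by simp [regAB, hjl], by simp⟩
    · rw [if_neg hj]
      have hjl : j ≠ ℓ := by omega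
      exact ⟨tmem2_nil_of_eq_zero fun ρ τ => by simp [regAB, hjl], by simp⟩
  | succ nF ih =>
    intro hpc n hn j
    have hpc' : PivCond A ℓ e nF := fun n hn j hj => hpc n (Nat.lt_succ_of_lt hn) j hj
    have ih' := ih hpc'
    by_cases hle : n ≤ nF
    · have e1 : rowEntry2 (rows2 S A ℓ e D Wn Wd a0 a1 b0 b1 (nF + 1)) (nF + 1) n j =
          rowEntry2 (rows2 S A ℓ e D Wn Wd a0 a1 b0 b1 nF) nF n j := by
        simp only [rowEntry2, rows2, show nF + 1 - n = (nF - n) + 1 by omega, List.getD_cons_succ]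
      rw [e1]; exact ih' n hle j
    · obtain rfl : n = nF + 1 := by omega
      set row : List TPoly := (rows2 S A ℓ e D Wn Wd a0 a1 b0 b1 nF).getD 0 [] with hrowdef
      have hrow : ∀ j', TMem2 S ((1 : ℚ) / 2 ^ e) ((Wn : ℝ) / Wd)
          (fun ρ τ => regAB ((a0 : ℝ) + (a1 : ℝ) * τ) ((b0 : ℝ) + (b1 : ℝ) * τ) ((A : ℝ) + ρ) ℓ nF j') (row.getD j' []) :=
        fun j' => by simpa [rowEntry2, hrowdef] using (ih' nF le_rfl j').1
      have hlen : ∀ j', (row.getD j' []).length ≤ D + 1 :=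
        fun j' => by simpa [rowEntry2, hrowdef] using (ih' nF le_rfl j').2
      have e1 : rowEntry2 (rows2 S A ℓ e D Wn Wd a0 a1 b0 b1 (nF + 1)) (nF + 1) (nF + 1) j =
          (stepRow2 S A ℓ e D Wn Wd a0 a1 b0 b1 nF row).getD j [] := by
        simp only [rowEntry2, rows2, Nat.sub_self, List.getD_cons_zero, headD_eq_getD_zero, hrowdef]
      rw [e1, stepRow2, getD_vtab]
      by_cases hj : j < ℓ + nF + 2
      · rw [if_pos hj]
        by_cases hR : InDescendantRange ℓ (nF + 1) j
        · by_cases hx : nF = 0 ∧ j + 1 = ℓ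
          · rw [stepEntry2, if_pos hR, if_pos hx]
            obtain ⟨rfl, hjℓ⟩ := hx
            have hℓ : 1 ≤ ℓ := by omega
            obtain rfl : j = ℓ - 1 := by omega
            exact ⟨tmem_poleTM2 _ _ A hℓ a0 a1 b0 b1, by simp [poleTM2]; omega⟩
          · refine ⟨tmem_stepEntry2 hS hWd hrow hlen hR hx (hpc nF (Nat.lt_succ_self _) j hj hR hx), ?_⟩
            rw [stepEntry2, if_pos hR, if_neg hx]
            exact (length_entryTMI2 _ _ _ _ _ _ _ _ _ _ _).le
        · rw [stepEntry2, if_neg hR]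
          exact ⟨tmem2_nil_of_eq_zero fun ρ τ => regAB_eq_zero_of_not_inDescendantRange _ _ _ hR, by simp⟩
      · rw [if_neg hj]
        have hR : ¬ InDescendantRange ℓ (nF + 1) j := by
          intro h; obtain ⟨_, h2, _⟩ := h; omega
        exact ⟨tmem2_nil_of_eq_zero fun ρ τ => regAB_eq_zero_of_not_inDescendantRange _ _ _ hR, by simp⟩

/-- **Kernel-facing corollary**: the τ-triple Taylor model of `(ρ, τ) ↦ (Δ − b_ℓ) A_{n,j}(a(τ), b(τ); A+ρ, ℓ)`, `a = a₀ + a₁τ`, `b = b₀ + b₁τ`,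
`|τ| ≤ Wn/Wd`, `|ρ| ≤ 2^{-e}`. [cite: DolanOsborn2004, §3 eq. (3.12)] -/
theorem tmem_rows2 {S : ℕ} (hS : 0 < S) {Wn : ℤ} {Wd : ℕ} (hWd : 0 < Wd) {A : ℚ} {ℓ e D nF : ℕ} (hD : 2 ≤ D)
    (hpiv : pivOK A ℓ e nF = true) (a0 a1 b0 b1 : ℚ) {n : ℕ} (hn : n ≤ nF) (j : ℕ) :
    TMem2 S ((1 : ℚ) / 2 ^ e) ((Wn : ℝ) / Wd)
      (fun ρ τ => regAB ((a0 : ℝ) + (a1 : ℝ) * τ) ((b0 : ℝ) + (b1 : ℝ) * τ) ((A : ℝ) + ρ) ℓ n j)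
      (rowEntry2 (rows2 S A ℓ e D Wn Wd a0 a1 b0 b1 nF) nF n j) :=
  (rows2_ok hS hWd A ℓ e D hD a0 a1 b0 b1 nF (pivCond_of_pivOK hpiv) n hn j).1

/-! ### From a `TPMem` witness to plain coefficient lists (what the merged-2 part layer consumes) -/

/-- **Splitting a triple-model witness**: fixed `τ⁰/τ¹` coefficient lists and, for every admissible `τ`, a `τ²` list, with the evaluation identity.
[folklore] -/
theorem tpmem_split {S : ℕ} {W : ℝ} : ∀ {as : List (ℝ → ℝ)} {P : TPoly}, TPMem S W as P →
    ∃ c0s c1s : List ℝ, PMem S c0s (P.map (·.c0)) ∧ PMem S c1s (P.map (·.c1)) ∧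
      ∀ τ : ℝ, |τ| ≤ W → ∃ c2s : List ℝ, PMem S c2s (P.map (·.c2)) ∧
        ∀ ρ : ℝ, evalF as ρ τ = evalR c0s ρ + τ * evalR c1s ρ + τ ^ 2 * evalR c2s ρ
  | _, _, List.Forall₂.nil =>
      ⟨[], [], pmem_nil S, pmem_nil S, fun τ _ => ⟨[], pmem_nil S, fun ρ => by simp [evalF, evalR]⟩⟩
  | _, _, List.Forall₂.cons (a := a) (b := x) h t => by
      obtain ⟨c0, c1, hc0, hc1, hτ⟩ := h
      obtain ⟨c0s, c1s, h0s, h1s, hrest⟩ := tpmem_split t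
      refine ⟨c0 :: c0s, c1 :: c1s, ?_, ?_, fun τ hτW => ?_⟩
      · simpa using pmem_cons hc0 h0s
      · simpa using pmem_cons hc1 h1s
      · obtain ⟨c2, hc2, ea⟩ := hτ τ hτW
        obtain ⟨c2s, h2s, es⟩ := hrest τ hτW
        refine ⟨c2 :: c2s, by simpa using pmem_cons hc2 h2s, fun ρ => ?_⟩
        simp only [evalF, evalR, ea, es ρ]
        ring

/-- **The `τ²`-slot bound list**: for `|τ| ≤ Wn/Wd` and `c2s ∈ P.map c2`, the nonnegative list `|c₂,k|·τ²` lies in the bound polynomial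
`t3split`'s third component carries (`[0, ⌈⌈|c₂| Wn/Wd⌉ Wn/Wd⌉]` coefficientwise). [folklore] -/
theorem pmem_t3bound {S : ℕ} {Wn : ℤ} {Wd : ℕ} (hWd : 0 < Wd) {τ : ℝ} (hτ : |τ| ≤ (Wn : ℝ) / Wd) :
    ∀ {c2s : List ℝ} {P : TPoly}, PMem S c2s (P.map (·.c2)) →
      PMem S (c2s.map fun c => |c| * τ ^ 2)
        (P.map fun c => (⟨0, Literature.Analysis.ValidatedNumerics.Numerics.cdiv
          (Literature.Analysis.ValidatedNumerics.Numerics.cdiv (c.c2.absHi * Wn) Wd * Wn) Wd⟩ : MI))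
  | c2s, [], h => by
      cases c2s with
      | nil => exact pmem_nil S
      | cons _ _ => exact absurd (List.Forall₂.length_eq h) (by simp)
  | c2s, x :: P, h => by
      cases c2s with
      | nil => exact absurd (List.Forall₂.length_eq h) (by simp)
      | cons c cs =>
          have h' : PMem S (c :: cs) (x.c2 :: P.map (·.c2)) := by simpa using h
          cases h' with
          | cons hc ht =>
              refine List.Forall₂.cons ?_ (pmem_t3bound hWd hτ ht)
              have b1 := T3.absW_bound (S := S) (Wn := Wn) hWd hc hτ
              have b2 := T3.absW_bound' (S := S) hWd b1 hτ
              have hS : (0 : ℝ) ≤ (S : ℝ) := by positivity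
              refine ⟨?_, ?_⟩
              · simp only [Int.cast_zero]; positivity
              · have e : |c| * τ ^ 2 * S = |τ * (τ * c)| * S := by
                  rw [abs_mul, abs_mul, ← sq_abs τ]; ring
                -- the inner rounded bound is nonnegative, so `absHi ⟨0, A⟩ = A`
                have hWn : (0 : ℝ) ≤ (Wn : ℝ) := by
                  have hWd' : (0 : ℝ) < (Wd : ℝ) := by exact_mod_cast hWd
                  have := le_trans (abs_nonneg τ) hτ
                  rcases lt_or_ge (Wn : ℝ) 0 with hneg | hge
                  · have : (Wn : ℝ) / Wd < 0 := div_neg_of_neg_of_pos hneg hWd'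
                    linarith
                  · exact hge
                set A : ℤ := Literature.Analysis.ValidatedNumerics.Numerics.cdiv (x.c2.absHi * Wn) Wd with hA
                have hA0 : 0 ≤ A := by
                  have h1 := Literature.Analysis.ValidatedNumerics.Numerics.le_cdiv_mul_real (a := x.c2.absHi * Wn) (b := (Wd : ℤ)) (by exact_mod_cast hWd)
                  have hnum : (0 : ℝ) ≤ ((x.c2.absHi * Wn : ℤ) : ℝ) := by
                    push_cast; exact mul_nonneg (by exact_mod_cast absHi_nonneg _) hWn
                  have hWd' : (0 : ℝ) < ((Wd : ℤ) : ℝ) := by exact_mod_cast hWd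
                  have : (0 : ℝ) ≤ ((A : ℤ) : ℝ) := by
                    rcases lt_or_ge (((A : ℤ) : ℝ)) 0 with hneg | hge
                    · nlinarith
                    · exact hge
                  exact_mod_cast this
                have habs : (MI.absHi ⟨0, A⟩ : ℤ) = A := by
                  unfold MI.absHi; rw [abs_zero, abs_of_nonneg hA0]; exact max_eq_right hA0
                rw [e]
                have b2' := b2
                simp only [T3.absW] at b2'
                rw [habs] at b2'
                exact b2'

end HRTMAB2

end Summit.CriticalPhenomena.Ising3D
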